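import Summits.QuantumAdvantage.QuantumAdvantage.Theses.SparsityDial
import Summits.QuantumAdvantage.QuantumAdvantage.Theorems.AbelianDialA
import HarnessLib

/-!
# SparsityDial — closer of the glue item `CounterSplitGlue3b` of the gen-2 resplit of `DenseGenericLoss3` (27656)

Cell decomp-qadv, writer; lens-2 g23 «AbelianDial» (critic 69v55/69v56).  The generated glue
`CounterLoss3 → AbelianLoss3 → NonAbelianLoss3 → DenseGenericLoss3` is closed BY NAME from the landed node part A
(`Theorems.AbelianDial.closesD` over `Theorems.SparsityDial.counterSplitGlue3`); the route-file children are the node's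
`AbelianLoss3` / `NonAbelianLoss3` by `Iff.rfl`.
-/

namespace Summit.QuantumAdvantage.QuantumAdvantage.Theorems.AbelianDial

/-- **The glue item `CounterSplitGlue3b` of route SparsityDial holds.** -/
theorem counterSplitGlue3b_holds :
    Summit.QuantumAdvantage.QuantumAdvantage.Theses.SparsityDial.CounterSplitGlue3b :=
  fun hA hS hG => closesD hA hS hG

end Summit.QuantumAdvantage.QuantumAdvantage.Theorems.AbelianDial
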